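import Literature.Probability.Percolation.TargetExplorationHK
import HarnessLib

/-!
# The full exploration of the open cluster of a vertex SET, its decision tree, and the
# decision-tree Harris–Kleitman inequality along it ("cluster-conditional Harris" for `C_N`)

Gladkov, *Percolation Inequalities and Decision Trees*,
arXiv:2408.08457v2 (2024), Def. 2.4, Example 2.5 (the exploration of an open cluster as a decision
tree) and Theorem 3.2 (p. 4, decision-tree Harris–Kleitman): for the set `S = S(C₁)` revealed by ANY
decision tree reading `C₁` and up-closed `A, B`, `P(C₁ ∈ A, C₁ →_S C₂ ∈ B) ≥ P(A) P(B)`.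

`TargetExploration*.lean` formalise the exploration of the cluster of ONE vertex `o`, stopped at a
target set, revealing only BOUNDARY edges.  The two-source lemma of the conditioned covariance
transfer (used for the additive gluing inequality `AdditiveGluing`, its Lemma (★_N)) needs the exploration of the cluster `C_N` of a vertex SET `N` which reveals EVERY edge of
`D` with at least one reached endpoint (so that, on the explored data, the clusters meeting `N` are
completely determined and the unrevealed edges are exactly the edges of `D` missing `C_N`).  This file
(all proved):

* `bnd`, `step`, `init`, `run`, `fin`, `reached`, `revealedAt` — the exploration from the root set `N`
  among the edges `D`: reveal, one at a time (choice by `Gladkov.pick`), an unrevealed edge of `D` with a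
  reached endpoint; an open edge adds its endpoints;
* `Inv`, `inv_fin`, `bnd_fin` — invariant and termination (after `#D + 1` steps nothing is left to reveal);
* `mem_reached_iff` — the reached set is the `K ∩ D`-open cluster of `N`;
  `mem_revealedAt_iff` — the revealed set is the set of edges of `D` meeting that cluster;
* `run_congr`, `selfDetermined_revealedAt` — self-determination (Gladkov Lemma 3.1 applies);
* `ttree`, `revealedAt_eq_revealed`, **`PrW_mul_PrW_le_Pr2W_hybrid`** — the exploration as a
  `DecisionTree.DTree` and Theorem 3.2 for it:
  `P(X) P(Y) ≤ P⊗P{(C₁, C₂) : C₁ ∈ X, C₁ →_{S_N(C₁)} C₂ ∈ Y}` for up-closed `X, Y`;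
* `reached_splice`, `revealedAt_splice`, `reachable_splice_iff_of_not_mem_reached` — what the hybrid
  `C₁ →_{S_N(C₁)} C₂` looks like: the same cluster of `N` as `C₁`, and, from a vertex outside it, the
  connectivity of `C₂` through the edges of `D` missing `C_N(C₁)` ("the world `G ∖ C_N`").

## References
* N. Gladkov, *Percolation Inequalities and Decision Trees*, arXiv:2408.08457v2 (2024), Def. 2.4,
  Example 2.5, Lemma 3.1, Theorem 3.2. [Gladkov2024]
* J. van den Berg, O. Häggström, J. Kahn, *Some conditional correlation inequalities for percolation and
  related processes*, Random Struct. Alg. 29 (2006), eq. (6) (the Markov property at an explored set). [VandenbergHaggstromKahn2005]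
-/

noncomputable section

open Classical

namespace Literature.Probability.Percolation

namespace SetClusterExploration

open Finset DecisionTree
open TargetExploration (St)

variable {V : Type*} [Fintype V] [DecidableEq V]

/-! ### The exploration -/

section Defs

variable (D : Finset (Sym2 V)) (N : Finset V)

/-- The endpoints of an edge, as a finset. [folklore] -/
def ends (e : Sym2 V) : Finset V := univ.filter fun v => v ∈ e

/-- The boundary of a state: unrevealed edges of `D` with at least one reached endpoint (internal edges
included, so that the final revealed set is every edge of `D` meeting the cluster).
[cite: Gladkov2024, §2 Example 2.5] -/
def bnd (σ : St V) : Finset (Sym2 V) := (D \ σ.rev).filter fun e => ∃ u ∈ σ.vis, u ∈ e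

/-- One step on the configuration `K`: reveal a boundary edge (if any); if it is open, add its endpoints.
[cite: Gladkov2024, §2 Example 2.5] -/
def step (K : Finset (Sym2 V)) (σ : St V) : St V :=
  match Gladkov.pick (bnd D σ) with
  | none => σ
  | some e => if e ∈ K then ⟨σ.vis ∪ ends e, insert e σ.rev⟩ else ⟨σ.vis, insert e σ.rev⟩

/-- The initial state: the root set reached, nothing revealed. [folklore] -/
def init : St V := ⟨N, ∅⟩

/-- The state after `k` steps. [cite: Gladkov2024, §2 Example 2.5] -/
def run (K : Finset (Sym2 V)) : ℕ → St V
  | 0 => init N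
  | k + 1 => step D K (run K k)

/-- The final state (fuel `#D + 1`, enough by `bnd_fin`). [folklore] -/
def fin (K : Finset (Sym2 V)) : St V := run D N K (D.card + 1)

/-- The reached set of the full exploration of the cluster of `N`. [folklore] -/
def reached (K : Finset (Sym2 V)) : Finset V := (fin D N K).vis

/-- The revealed edge set `S_N(K)` of the full exploration of the cluster of `N`. [cite: Gladkov2024, Def. 2.4] -/
def revealedAt (K : Finset (Sym2 V)) : Finset (Sym2 V) := (fin D N K).rev

end Defs

/-! ### Basic facts about one step -/

section Basic

variable {D : Finset (Sym2 V)} {N : Finset V}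

/-- Membership in `ends`. [folklore] -/
@[simp] private theorem mem_ends {e : Sym2 V} {v : V} : v ∈ ends e ↔ v ∈ e := by
  simp [ends]

omit [Fintype V] in
/-- Membership in the boundary. [cite: Gladkov2024, §2 Example 2.5 (p. 3)] -/
theorem mem_bnd {σ : St V} {e : Sym2 V} :
    e ∈ bnd D σ ↔ (e ∈ D ∧ e ∉ σ.rev) ∧ ∃ u ∈ σ.vis, u ∈ e := by
  simp [bnd, mem_filter, mem_sdiff]

/-- With an empty boundary a step does nothing. [cite: Gladkov2024, §2 Example 2.5 (p. 3)] -/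
theorem step_of_bnd_eq_empty {K : Finset (Sym2 V)} {σ : St V} (h : bnd D σ = ∅) : step D K σ = σ := by
  unfold step
  rw [TargetExploration.pick_eq_none_iff.2 h]

/-- With a nonempty boundary a step reveals the picked boundary edge. [cite: Gladkov2024, §2 Example 2.5 (p. 3)] -/
theorem step_of_bnd_ne_empty {K : Finset (Sym2 V)} {σ : St V} (h : bnd D σ ≠ ∅) :
    ∃ e ∈ bnd D σ, Gladkov.pick (bnd D σ) = some e ∧
      step D K σ = (if e ∈ K then ⟨σ.vis ∪ ends e, insert e σ.rev⟩ else ⟨σ.vis, insert e σ.rev⟩) := by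
  unfold step
  cases hp : Gladkov.pick (bnd D σ) with
  | none => exact absurd (TargetExploration.pick_eq_none_iff.1 hp) h
  | some e => exact ⟨e, Gladkov.mem_of_pick_eq_some hp, rfl, rfl⟩

/-- The revealed set grows by one step. [cite: Gladkov2024, §2 Example 2.5 (p. 3)] -/
theorem rev_subset_step (K : Finset (Sym2 V)) (σ : St V) : σ.rev ⊆ (step D K σ).rev := by
  by_cases h : bnd D σ = ∅
  · rw [step_of_bnd_eq_empty h]
  · obtain ⟨e, -, -, hstep⟩ := step_of_bnd_ne_empty (K := K) h
    rw [hstep]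
    split_ifs <;> exact subset_insert e σ.rev

/-- The reached set grows by one step. [cite: Gladkov2024, §2 Example 2.5 (p. 3)] -/
theorem vis_subset_step (K : Finset (Sym2 V)) (σ : St V) : σ.vis ⊆ (step D K σ).vis := by
  by_cases h : bnd D σ = ∅
  · rw [step_of_bnd_eq_empty h]
  · obtain ⟨e, -, -, hstep⟩ := step_of_bnd_ne_empty (K := K) h
    rw [hstep]
    split_ifs
    · exact subset_union_left
    · exact subset_rfl

/-- With a nonempty boundary the revealed set grows strictly. [cite: Gladkov2024, §2 Example 2.5 (p. 3)] -/
theorem card_rev_step {K : Finset (Sym2 V)} {σ : St V} (h : bnd D σ ≠ ∅) :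
    σ.rev.card + 1 ≤ (step D K σ).rev.card := by
  obtain ⟨e, he, -, hstep⟩ := step_of_bnd_ne_empty (K := K) h
  have herev : e ∉ σ.rev := ((mem_bnd.1 he).1).2
  rw [hstep]
  split_ifs <;> simp [card_insert_of_notMem herev]

/-- `run (k+1) = step (run k)`. [cite: Gladkov2024, §2 Example 2.5 (p. 3)] -/
theorem run_succ (K : Finset (Sym2 V)) (k : ℕ) : run D N K (k + 1) = step D K (run D N K k) := rfl

/-- The revealed sets along the run increase. [cite: Gladkov2024, §2 Example 2.5 (p. 3)] -/
theorem rev_run_mono (K : Finset (Sym2 V)) {k l : ℕ} (h : k ≤ l) :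
    (run D N K k).rev ⊆ (run D N K l).rev := by
  induction l, h using Nat.le_induction with
  | base => exact subset_rfl
  | succ l _ ih => exact ih.trans (by rw [run_succ]; exact rev_subset_step K _)

end Basic

/-! ### The invariant -/

/-- The invariant of the full exploration of the `K`-open cluster of the set `N` among the edges `D`.
[cite: Gladkov2024, §6.2 (structure of the revealed set)] -/
structure Inv (D : Finset (Sym2 V)) (N : Finset V) (K : Finset (Sym2 V)) (σ : St V) : Prop where
  /-- the root set is reached -/
  root : N ⊆ σ.vis
  /-- only edges of `D` are revealed -/
  rev_sub : σ.rev ⊆ D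
  /-- every revealed edge touches the reached set -/
  touch : ∀ e ∈ σ.rev, ∃ u ∈ σ.vis, u ∈ e
  /-- open revealed edges have both endpoints reached -/
  open_vis : ∀ e ∈ σ.rev, e ∈ K → ∀ v ∈ e, v ∈ σ.vis
  /-- reached vertices are joined to the root set by open revealed edges -/
  reach : ∀ v ∈ σ.vis, ∃ s ∈ N, (openGraph (↑(σ.rev ∩ K) : Set (Sym2 V))).Reachable s v

section Invariant

variable {D : Finset (Sym2 V)} {N : Finset V} {K : Finset (Sym2 V)}

omit [Fintype V] in
/-- The initial state satisfies the invariant. [cite: Gladkov2024, §6.2 (structure of the revealed set)] -/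
theorem inv_init : Inv D N K (init N) where
  root := by simp [init]
  rev_sub := by simp [init]
  touch := by simp [init]
  open_vis := by simp [init]
  reach := by
    intro v hv
    exact ⟨v, by simpa [init] using hv, SimpleGraph.Reachable.refl _⟩

/-- **The invariant is preserved by a step.** [cite: Gladkov2024, §6.2 (structure of the revealed set)] -/
theorem inv_step {σ : St V} (hσ : Inv D N K σ) : Inv D N K (step D K σ) := by
  by_cases h : bnd D σ = ∅
  · rw [step_of_bnd_eq_empty h]; exact hσ
  obtain ⟨e, he, -, hstep⟩ := step_of_bnd_ne_empty (K := K) h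
  obtain ⟨⟨heD, herev⟩, u, hu, hue⟩ := mem_bnd.1 he
  have hmono : (openGraph (↑(σ.rev ∩ K) : Set (Sym2 V))) ≤
      openGraph (↑(insert e σ.rev ∩ K) : Set (Sym2 V)) :=
    openGraph_mono (coe_subset.2 (inter_subset_inter (subset_insert _ _) subset_rfl))
  rw [hstep]
  split_ifs with hK
  · -- the revealed edge is open: its endpoints are added
    refine ⟨hσ.root.trans subset_union_left, insert_subset heD hσ.rev_sub, ?_, ?_, ?_⟩
    · intro e' he'
      rcases mem_insert.1 he' with rfl | he'
      · exact ⟨u, mem_union_left _ hu, hue⟩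
      · obtain ⟨w, hw, hwe⟩ := hσ.touch e' he'
        exact ⟨w, mem_union_left _ hw, hwe⟩
    · intro e' he' heK x hx
      rcases mem_insert.1 he' with rfl | he'
      · exact mem_union_right _ (mem_ends.2 hx)
      · exact mem_union_left _ (hσ.open_vis e' he' heK x hx)
    · intro x hx
      rcases mem_union.1 hx with hx | hx
      · obtain ⟨s, hs, hsx⟩ := hσ.reach x hx
        exact ⟨s, hs, hsx.mono hmono⟩
      · rw [mem_ends] at hx
        obtain ⟨s, hs, hsu⟩ := hσ.reach u hu
        refine ⟨s, hs, (hsu.mono hmono).trans ?_⟩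
        by_cases hux : u = x
        · subst hux; exact SimpleGraph.Reachable.refl _
        · have hexu : e = s(u, x) := (Sym2.mem_and_mem_iff hux).1 ⟨hue, hx⟩
          have hadj : (openGraph (↑(insert e σ.rev ∩ K) : Set (Sym2 V))).Adj u x := by
            rw [openGraph_adj]
            refine ⟨?_, hux⟩
            rw [← hexu]
            exact mem_coe.2 (mem_inter.2 ⟨mem_insert_self _ _, hK⟩)
          exact hadj.reachable
  · -- the revealed edge is closed
    refine ⟨hσ.root, insert_subset heD hσ.rev_sub, ?_, ?_, ?_⟩
    · intro e' he'
      rcases mem_insert.1 he' with rfl | he'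
      · exact ⟨u, hu, hue⟩
      · exact hσ.touch e' he'
    · intro e' he' heK x hx
      rcases mem_insert.1 he' with rfl | he'
      · exact absurd heK hK
      · exact hσ.open_vis e' he' heK x hx
    · intro x hx
      obtain ⟨s, hs, hsx⟩ := hσ.reach x hx
      exact ⟨s, hs, hsx.mono hmono⟩

/-- The invariant holds along the run. [cite: Gladkov2024, §6.2 (structure of the revealed set)] -/
theorem inv_run (K : Finset (Sym2 V)) : ∀ k, Inv D N K (run D N K k)
  | 0 => inv_init
  | k + 1 => inv_step (inv_run K k)

/-- The invariant holds at the final state. [cite: Gladkov2024, §6.2 (structure of the revealed set)] -/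
theorem inv_fin (K : Finset (Sym2 V)) : Inv D N K (fin D N K) := inv_run K _

/-! ### Termination -/

/-- Either the boundary is empty by time `k`, or at least `k` edges have been revealed. [cite: Gladkov2024, §6.2 (structure of the revealed set)] -/
theorem bnd_empty_or_le_card (K : Finset (Sym2 V)) :
    ∀ k, bnd D (run D N K k) = ∅ ∨ k ≤ (run D N K k).rev.card
  | 0 => Or.inr (Nat.zero_le _)
  | k + 1 => by
      by_cases h : bnd D (run D N K k) = ∅
      · left; rw [run_succ, step_of_bnd_eq_empty h]; exact h
      · rcases bnd_empty_or_le_card K k with h' | h'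
        · exact absurd h' h
        · exact Or.inr (le_trans (Nat.add_le_add_right h' 1) (card_rev_step h))

/-- **The exploration is complete at the final state**: no edge of `D` with a reached endpoint is left
unrevealed. [cite: Gladkov2024, §6.2 (structure of the revealed set)] -/
theorem bnd_fin (K : Finset (Sym2 V)) : bnd D (fin D N K) = ∅ := by
  rcases bnd_empty_or_le_card (D := D) (N := N) K (D.card + 1) with h | h
  · exact h
  · exact absurd ((card_le_card (inv_fin (D := D) (N := N) K).rev_sub).trans_lt
      (Nat.lt_of_succ_le h)) (lt_irrefl _)

/-! ### What the exploration reveals -/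

omit [Fintype V] [DecidableEq V] in
/-- A set containing the start of a walk and closed under adjacency along the walk's graph contains its
end. [folklore] -/
private theorem mem_of_walk_closed {G : SimpleGraph V} {S : Set V}
    (hS : ∀ a b, G.Adj a b → a ∈ S → b ∈ S) {u v : V} (p : G.Walk u v) (hu : u ∈ S) : v ∈ S := by
  induction p with
  | nil => exact hu
  | cons hadj _ ih => exact ih (hS _ _ hadj hu)

/-- **The reached set is the open cluster of `N`** (through the edges of `K ∩ D`).
[cite: Gladkov2024, §2 Example 2.5] -/
theorem mem_reached_iff {v : V} :
    v ∈ reached D N K ↔ ∃ s ∈ N, (openGraph (↑(K ∩ D) : Set (Sym2 V))).Reachable s v := by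
  have hI := inv_fin (D := D) (N := N) K
  constructor
  · intro hv
    obtain ⟨s, hs, hsv⟩ := hI.reach v hv
    refine ⟨s, hs, hsv.mono (openGraph_mono (coe_subset.2 ?_))⟩
    intro e he
    rw [mem_inter] at he ⊢
    exact ⟨he.2, hI.rev_sub he.1⟩
  · rintro ⟨s, hs, hsv⟩
    obtain ⟨p⟩ := hsv
    have hclosed : ∀ a b, (openGraph (↑(K ∩ D) : Set (Sym2 V))).Adj a b →
        a ∈ (↑(fin D N K).vis : Set V) → b ∈ (↑(fin D N K).vis : Set V) := by
      intro a b hab ha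
      rw [openGraph_adj] at hab
      obtain ⟨he, hne⟩ := hab
      rw [mem_coe, mem_inter] at he
      rw [mem_coe] at ha ⊢
      -- the edge `s(a,b)` touches the reached set, so it has been revealed (the final boundary is empty)
      by_contra hb
      by_cases hrev : s(a, b) ∈ (fin D N K).rev
      · exact hb (hI.open_vis _ hrev he.1 b (Sym2.mem_mk_right a b))
      · have hmem : s(a, b) ∈ bnd D (fin D N K) :=
          mem_bnd.2 ⟨⟨he.2, hrev⟩, a, ha, Sym2.mem_mk_left a b⟩
        rw [bnd_fin] at hmem
        exact notMem_empty _ hmem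
    have := mem_of_walk_closed hclosed p (mem_coe.2 (hI.root hs))
    exact mem_coe.1 this

/-- **The revealed set is the set of edges of `D` meeting the cluster of `N`.**
[cite: Gladkov2024, §2 Example 2.5] -/
theorem mem_revealedAt_iff {e : Sym2 V} :
    e ∈ revealedAt D N K ↔ e ∈ D ∧ ∃ u ∈ reached D N K, u ∈ e := by
  have hI := inv_fin (D := D) (N := N) K
  constructor
  · intro he
    exact ⟨hI.rev_sub he, hI.touch e he⟩
  · rintro ⟨heD, u, hu, hue⟩
    by_contra hrev
    have hmem : e ∈ bnd D (fin D N K) := mem_bnd.2 ⟨⟨heD, hrev⟩, u, hu, hue⟩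
    rw [bnd_fin] at hmem
    exact notMem_empty _ hmem

/-- Open revealed edges lie inside the reached set. [cite: Gladkov2024, §2 Example 2.5 (p. 3)] -/
theorem mem_reached_of_mem_revealedAt {e : Sym2 V} (he : e ∈ revealedAt D N K) (heK : e ∈ K)
    {v : V} (hv : v ∈ e) : v ∈ reached D N K :=
  (inv_fin (D := D) (N := N) K).open_vis e he heK v hv

/-! ### Self-determination -/

/-- A step depends on the configuration only through the edge it reveals. [cite: Gladkov2024, Lemma 3.1] -/
theorem step_congr {K K' : Finset (Sym2 V)} {σ : St V}
    (h : ∀ e ∈ (step D K σ).rev, (e ∈ K ↔ e ∈ K')) : step D K' σ = step D K σ := by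
  by_cases hh : bnd D σ = ∅
  · rw [step_of_bnd_eq_empty hh, step_of_bnd_eq_empty hh]
  obtain ⟨e, -, hpick, hstep⟩ := step_of_bnd_ne_empty (K := K) hh
  obtain ⟨e', -, hpick', hstep'⟩ := step_of_bnd_ne_empty (K := K') hh
  rw [hpick, Option.some.injEq] at hpick'
  subst hpick'
  have he : e ∈ (step D K σ).rev := by
    rw [hstep]; split_ifs <;> exact mem_insert_self e σ.rev
  have hiff := h e he
  rw [hstep', hstep]
  by_cases hK : e ∈ K
  · rw [if_pos hK, if_pos (hiff.1 hK)]
  · rw [if_neg hK, if_neg (fun h' => hK (hiff.2 h'))]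

/-- The run depends on the configuration only through the revealed edges. [cite: Gladkov2024, Lemma 3.1] -/
theorem run_congr {K K' : Finset (Sym2 V)} :
    ∀ k, (∀ e ∈ (run D N K k).rev, (e ∈ K ↔ e ∈ K')) → run D N K' k = run D N K k
  | 0, _ => rfl
  | k + 1, h => by
      have ih := run_congr k fun e he => h e (rev_subset_step K _ he)
      rw [run_succ, run_succ, ih]
      exact step_congr h

/-- **Self-determination**: a configuration agreeing with `K` on `S_N(K)` ends in the same state.
[cite: Gladkov2024, Lemma 3.1] -/
theorem fin_congr {K K' : Finset (Sym2 V)} (h : ∀ e ∈ revealedAt D N K, (e ∈ K ↔ e ∈ K')) :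
    fin D N K' = fin D N K := run_congr _ h

/-- `K ↦ S_N(K)` is self-determined (`DecisionTree.SelfDetermined`). [cite: Gladkov2024, Lemma 3.1] -/
theorem selfDetermined_revealedAt : SelfDetermined (revealedAt D N) :=
  fun _ _ h => congrArg St.rev (fin_congr h)

/-! ### The hybrid `C₁ →_{S_N(C₁)} C₂` -/

/-- The hybrid agrees with `C₁` on the revealed set, hence is explored identically. [cite: Gladkov2024, Lemma 3.1] -/
theorem fin_splice (C₁ C₂ : Finset (Sym2 V)) :
    fin D N (splice (revealedAt D N C₁) C₁ C₂) = fin D N C₁ :=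
  fin_congr fun e he => (splice_agree _ C₁ C₂ e he).symm

/-- The hybrid has the same cluster of `N` as `C₁`. [cite: Gladkov2024, Lemma 3.1] -/
theorem reached_splice (C₁ C₂ : Finset (Sym2 V)) :
    reached D N (splice (revealedAt D N C₁) C₁ C₂) = reached D N C₁ :=
  congrArg St.vis (fin_splice C₁ C₂)

/-- The hybrid reveals the same set as `C₁`. [cite: Gladkov2024, Lemma 3.1] -/
theorem revealedAt_splice (C₁ C₂ : Finset (Sym2 V)) :
    revealedAt D N (splice (revealedAt D N C₁) C₁ C₂) = revealedAt D N C₁ :=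
  congrArg St.rev (fin_splice C₁ C₂)

omit [Fintype V] [DecidableEq V] in
/-- If every edge of `E` meeting the vertex set `R` has both endpoints in `R`, a walk of `openGraph E`
started outside `R` never meets `R`, so it is a walk of the edges of `E` missing `R`. [folklore] -/
private theorem reachable_restrict_of_closed {E : Set (Sym2 V)} {R : Set V}
    (hE : ∀ e ∈ E, (∃ u ∈ R, u ∈ e) → ∀ w ∈ e, w ∈ R) {x z : V} (hx : x ∉ R)
    (h : (openGraph E).Reachable x z) :
    (openGraph {e ∈ E | ∀ w ∈ e, w ∉ R}).Reachable x z := by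
  obtain ⟨p⟩ := h
  induction p with
  | nil => exact SimpleGraph.Reachable.refl _
  | @cons a b c hadj p ih =>
      rw [openGraph_adj] at hadj
      obtain ⟨hab, hne⟩ := hadj
      have hb : b ∉ R := by
        intro hb
        exact hx (hE _ hab ⟨b, hb, Sym2.mem_mk_right a b⟩ a (Sym2.mem_mk_left a b))
      have hadj' : (openGraph {e ∈ E | ∀ w ∈ e, w ∉ R}).Adj a b := by
        rw [openGraph_adj]
        refine ⟨⟨hab, ?_⟩, hne⟩
        intro w hw
        rcases Sym2.mem_iff.1 hw with rfl | rfl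
        · exact hx
        · exact hb
      exact hadj'.reachable.trans (ih hb)

/-- **The world outside the explored cluster.**  For a vertex `x` not in the cluster of `N` of `C₁`,
connectivity from `x` through the edges of `D` in the hybrid `C₁ →_{S_N(C₁)} C₂` is connectivity from `x`
in `C₂` through the edges of `D` MISSING the cluster `C_N(C₁)`: the hybrid is "`C₂` resampled outside the
revealed set", and no open edge leaves `C_N(C₁)`. [cite: VandenbergHaggstromKahn2005, eq. (6) (p. 4)] -/
theorem reachable_splice_iff_of_not_mem_reached {C₁ C₂ : Finset (Sym2 V)} {x z : V}
    (hx : x ∉ reached D N C₁) :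
    (openGraph (↑(splice (revealedAt D N C₁) C₁ C₂ ∩ D) : Set (Sym2 V))).Reachable x z ↔
      (openGraph {e : Sym2 V | e ∈ C₂ ∧ e ∈ D ∧ ∀ w ∈ e, w ∉ reached D N C₁}).Reachable x z := by
  set R : Finset V := reached D N C₁ with hR
  set S := revealedAt D N C₁ with hS
  set H := splice S C₁ C₂ with hH
  constructor
  · intro h
    -- edges of `H ∩ D` meeting `R` are revealed, hence taken from `C₁`, hence open revealed: inside `R`
    have hcl : ∀ e ∈ (↑(H ∩ D) : Set (Sym2 V)), (∃ u ∈ (↑R : Set V), u ∈ e) →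
        ∀ w ∈ e, w ∈ (↑R : Set V) := by
      intro e he ⟨u, hu, hue⟩ w hw
      rw [mem_coe, mem_inter] at he
      rw [mem_coe] at hu ⊢
      have heS : e ∈ S := mem_revealedAt_iff.2 ⟨he.2, u, hu, hue⟩
      have heC₁ : e ∈ C₁ := (splice_agree S C₁ C₂ e heS).1 he.1
      exact mem_reached_of_mem_revealedAt heS heC₁ hw
    have h' := reachable_restrict_of_closed hcl (fun h => hx (mem_coe.1 h)) h
    refine h'.mono (openGraph_mono ?_)
    intro e he
    simp only [Set.mem_setOf_eq, mem_coe, mem_inter] at he ⊢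
    obtain ⟨⟨heH, heD⟩, hout⟩ := he
    have heS : e ∉ S := by
      intro heS
      obtain ⟨-, u, hu, hue⟩ := mem_revealedAt_iff.1 heS
      exact hout u hue (mem_coe.2 hu)
    exact ⟨(mem_splice.1 heH).elim (fun h => absurd h.1 heS) (fun h => h.2), heD,
      fun w hw hwR => hout w hw (mem_coe.2 hwR)⟩
  · intro h
    refine h.mono (openGraph_mono ?_)
    intro e he
    simp only [Set.mem_setOf_eq, mem_coe, mem_inter] at he ⊢
    obtain ⟨heC₂, heD, hout⟩ := he
    have heS : e ∉ S := by
      intro heS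
      obtain ⟨-, u, hu, hue⟩ := mem_revealedAt_iff.1 heS
      exact hout u hue hu
    exact ⟨mem_splice.2 (Or.inr ⟨heS, heC₂⟩), heD⟩

end Invariant

/-! ### The decision tree and the Harris–Kleitman inequality along it -/

section Tree

variable (D : Finset (Sym2 V))

/-- The full exploration as a decision tree started at the state `σ` with fuel `n`: query the picked
boundary edge and branch on the answer. [cite: Gladkov2024, Def. 2.4 and Example 2.5] -/
def ttree : ℕ → St V → DTree (Sym2 V)
  | 0, _ => .leaf
  | n + 1, σ =>
      match Gladkov.pick (bnd D σ) with
      | none => .leaf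
      | some e => .node e (ttree n ⟨σ.vis ∪ ends e, insert e σ.rev⟩) (ttree n ⟨σ.vis, insert e σ.rev⟩)

variable {D}

/-- **The tree reveals what the exploration reveals.** [cite: Gladkov2024, Def. 2.4 and Example 2.5] -/
theorem rev_iterate_step (K : Finset (Sym2 V)) :
    ∀ (n : ℕ) (σ : St V), ((step D K)^[n] σ).rev = σ.rev ∪ revealed (ttree D n σ) K
  | 0, σ => by simp [ttree, revealed]
  | n + 1, σ => by
      rw [Function.iterate_succ_apply]
      by_cases h : bnd D σ = ∅
      · rw [step_of_bnd_eq_empty h, Function.iterate_fixed (step_of_bnd_eq_empty h)]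
        simp [ttree, TargetExploration.pick_eq_none_iff.2 h, revealed]
      · obtain ⟨e, -, hpick, hstep⟩ := step_of_bnd_ne_empty (D := D) (K := K) h
        have htree : ttree D (n + 1) σ =
            .node e (ttree D n ⟨σ.vis ∪ ends e, insert e σ.rev⟩) (ttree D n ⟨σ.vis, insert e σ.rev⟩) := by
          simp only [ttree, hpick]
        rw [hstep, htree]
        by_cases he : e ∈ K
        · rw [if_pos he, rev_iterate_step K n]
          simp only [revealed, if_pos he, Finset.insert_union, Finset.union_insert]
        · rw [if_neg he, rev_iterate_step K n]
          simp only [revealed, if_neg he, Finset.insert_union, Finset.union_insert]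

/-- `run` is the iterated `step`. [folklore] -/
private theorem run_eq_iterate (N : Finset V) (K : Finset (Sym2 V)) :
    ∀ k : ℕ, run D N K k = (step D K)^[k] (init N)
  | 0 => rfl
  | k + 1 => by rw [run_succ, Function.iterate_succ_apply', run_eq_iterate N K k]

/-- **The revealed set of the full exploration is the set built by its decision tree.**
[cite: Gladkov2024, Def. 2.4 and Example 2.5] -/
theorem revealedAt_eq_revealed (N : Finset V) (K : Finset (Sym2 V)) :
    revealedAt D N K = revealed (ttree D (D.card + 1) (init N)) K := by
  rw [revealedAt, fin, run_eq_iterate, rev_iterate_step]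
  simp [init]

end Tree

section HK

variable (D : Finset (Sym2 V)) (N : Finset V) {p : Sym2 V → ℝ}

/-- **Decision-tree Harris–Kleitman inequality along the full exploration of the cluster of a set**
(Gladkov 2024, Theorem 3.2, for this tree; "cluster-conditional Harris" for `C_N`): for up-closed events
`X, Y` of one configuration and `0 ≤ p ≤ 1`,
`P(X) · P(Y) ≤ P⊗P{(C₁, C₂) : C₁ ∈ X, C₁ →_{S_N(C₁)} C₂ ∈ Y}`, where `S_N(C₁)` is the revealed set of the
full exploration of the cluster of `N` in `C₁` — i.e. the conditional expectations of two increasing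
events given the exploration data of `C_N` are positively correlated. [cite: Gladkov2024, Thm. 3.2 (p. 4)] -/
theorem PrW_mul_PrW_le_Pr2W_hybrid (hp0 : ∀ e, 0 ≤ p e) (hp1 : ∀ e, p e ≤ 1)
    {X Y : Set (Finset (Sym2 V))} (hX : IsUpperSet X) (hY : IsUpperSet Y) :
    PrW D p X * PrW D p Y ≤
      Pr2W D p {c | c.1 ∈ X ∧ splice (revealedAt D N c.1) c.1 c.2 ∈ Y} := by
  have h := PrW_mul_PrW_le_Pr2W_treeHK D hp0 hp1 (ttree D (D.card + 1) (init N)) hX hY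
  have hset : treeHK ∅ (ttree D (D.card + 1) (init N)) X Y =
      {c | c.1 ∈ X ∧ splice (revealedAt D N c.1) c.1 c.2 ∈ Y} := by
    ext c
    simp only [treeHK, hkWith, Finset.empty_union, Set.mem_setOf_eq, revealedAt_eq_revealed]
  rwa [hset] at h

/-- **The hybrid is again a percolation configuration**: the law of `C₁ →_{S_N(C₁)} C₂` under `P ⊗ P` is `P`
(Gladkov's Lemma 3.1 read on the first component of the swap). [cite: Gladkov2024, Lemma 3.1] -/
theorem Pr2W_hybrid_mem (p : Sym2 V → ℝ) (Y : Set (Finset (Sym2 V))) :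
    Pr2W D p {c | splice (revealedAt D N c.1) c.1 c.2 ∈ Y} = PrW D p Y := by
  have h := Pr2W_preimage_swapPair D p (selfDetermined_revealedAt (D := D) (N := N)) (Y ×ˢ Set.univ)
  have hset : swapPair (revealedAt D N) ⁻¹' (Y ×ˢ Set.univ) =
      {c | splice (revealedAt D N c.1) c.1 c.2 ∈ Y} := by
    ext c
    simp [swapPair]
  rw [hset] at h
  rw [h, Pr2W_prod, PrW_univ, mul_one]

/-- **Reindexing by the hybrid** (functional form of Lemma 3.1 for this tree): for every `f`,
`Σ_{(C₁,C₂)} w(C₁)w(C₂) f(C₁, C₂) = Σ_{(C₁,C₂)} w(C₁)w(C₂) f(C₁ →_S C₂, C₂ →_S C₁)`, `S = S_N(C₁)`.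
[cite: Gladkov2024, Lemma 3.1] -/
theorem sum_pair_reindex_hybrid (p : Sym2 V → ℝ) (f : Finset (Sym2 V) × Finset (Sym2 V) → ℝ) :
    ∑ x ∈ D.powerset ×ˢ D.powerset, wt2W D p x * f x =
      ∑ x ∈ D.powerset ×ˢ D.powerset, wt2W D p x * f (swapPair (revealedAt D N) x) :=
  sum_pair_reindexW D p (selfDetermined_revealedAt (D := D) (N := N)) f

/-- **Law of the hybrid, conditional form** (tower property): the conditional probabilities of `B` given the
exploration data of `C_N` (`DecisionTree.condSumW` along `S_N`) average to `P(B)`. [cite: Gladkov2024, Lemma 3.1] -/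
theorem sum_wtW_mul_condSumW (p : Sym2 V → ℝ) (B : Set (Finset (Sym2 V))) :
    ∑ K ∈ D.powerset, wtW D p K * condSumW D p (revealedAt D N) B K = PrW D p B := by
  rw [← Pr2W_hybrid_mem D N p B, Pr2W_eq_sum_ind, Finset.sum_product]
  refine Finset.sum_congr rfl fun K _ => ?_
  unfold condSumW
  rw [Finset.mul_sum]
  refine Finset.sum_congr rfl fun K₂ _ => ?_
  have : ind {c : Finset (Sym2 V) × Finset (Sym2 V) | splice (revealedAt D N c.1) c.1 c.2 ∈ B} (K, K₂) =
      ind B (splice (revealedAt D N K) K K₂) := by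
    by_cases h : splice (revealedAt D N K) K K₂ ∈ B
    · rw [ind_of_mem h, ind_of_mem (show (K, K₂) ∈ {c : Finset (Sym2 V) × Finset (Sym2 V) |
        splice (revealedAt D N c.1) c.1 c.2 ∈ B} from h)]
    · rw [ind_of_not_mem h, ind_of_not_mem (show (K, K₂) ∉ {c : Finset (Sym2 V) × Finset (Sym2 V) |
        splice (revealedAt D N c.1) c.1 c.2 ∈ B} from h)]
  rw [this, wt2W]
  ring

/-- The conditional probability given the exploration data is the same for the hybrid as for `C₁`.
[cite: Gladkov2024, Lemma 3.1] -/
theorem condSumW_splice (p : Sym2 V → ℝ) (B : Set (Finset (Sym2 V))) (K K₂ : Finset (Sym2 V)) :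
    condSumW D p (revealedAt D N) B (splice (revealedAt D N K) K K₂) = condSumW D p (revealedAt D N) B K :=
  condSumW_congr D p (selfDetermined_revealedAt (D := D) (N := N)) B
    fun e he => (splice_agree _ K K₂ e he).symm

/-- **Tower identity**: `E[1_X · E[1_Y | 𝓕_N]] = E[E[1_X | 𝓕_N] · E[1_Y | 𝓕_N]]`, in finitary form along the
exploration of `C_N`. [cite: Gladkov2024, Lemma 3.1] -/
theorem sum_wtW_ind_mul_condSumW (p : Sym2 V → ℝ) (X Y : Set (Finset (Sym2 V))) :
    ∑ K ∈ D.powerset, wtW D p K * ind X K * condSumW D p (revealedAt D N) Y K =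
      ∑ K ∈ D.powerset, wtW D p K * condSumW D p (revealedAt D N) X K *
        condSumW D p (revealedAt D N) Y K := by
  -- both sides as pair sums; the right one is the swap-reindexing of the left one
  have hL : ∑ K ∈ D.powerset, wtW D p K * ind X K * condSumW D p (revealedAt D N) Y K =
      ∑ x ∈ D.powerset ×ˢ D.powerset, wt2W D p x * (ind X x.1 * condSumW D p (revealedAt D N) Y x.1) := by
    rw [Finset.sum_product]
    refine Finset.sum_congr rfl fun K _ => ?_
    have : ∑ K₂ ∈ D.powerset, wt2W D p (K, K₂) * (ind X K * condSumW D p (revealedAt D N) Y K) =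
        wtW D p K * ind X K * condSumW D p (revealedAt D N) Y K * ∑ K₂ ∈ D.powerset, wtW D p K₂ := by
      rw [Finset.mul_sum]
      refine Finset.sum_congr rfl fun K₂ _ => ?_
      rw [wt2W]; ring
    rw [this, sum_wtW, mul_one]
  have hR : ∑ K ∈ D.powerset, wtW D p K * condSumW D p (revealedAt D N) X K *
        condSumW D p (revealedAt D N) Y K =
      ∑ x ∈ D.powerset ×ˢ D.powerset, wt2W D p x *
        (ind X (splice (revealedAt D N x.1) x.1 x.2) * condSumW D p (revealedAt D N) Y x.1) := by
    rw [Finset.sum_product]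
    refine Finset.sum_congr rfl fun K _ => ?_
    have : ∑ K₂ ∈ D.powerset, wt2W D p (K, K₂) *
          (ind X (splice (revealedAt D N K) K K₂) * condSumW D p (revealedAt D N) Y K) =
        wtW D p K * condSumW D p (revealedAt D N) Y K *
          ∑ K₂ ∈ D.powerset, wtW D p K₂ * ind X (splice (revealedAt D N K) K K₂) := by
      rw [Finset.mul_sum]
      refine Finset.sum_congr rfl fun K₂ _ => ?_
      rw [wt2W]; ring
    rw [this]
    unfold condSumW
    ring
  rw [hL, hR, sum_pair_reindex_hybrid D N p]
  refine Finset.sum_congr rfl fun x _ => ?_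
  simp only [swapPair]
  rw [condSumW_splice]

/-- **Decision-tree Harris–Kleitman, conditional-expectation form**: for up-closed `X, Y`,
`P(X) P(Y) ≤ Σ_K w(K) · P(X | 𝓕_N)(K) · P(Y | 𝓕_N)(K)` — the conditional probabilities of two increasing
events given the exploration data of `C_N` are positively correlated ("Lemma TH" of the conditioned
covariance transfer). [cite: Gladkov2024, Thm. 3.2 (p. 4)] -/
theorem PrW_mul_PrW_le_sum_condSumW_mul (hp0 : ∀ e, 0 ≤ p e) (hp1 : ∀ e, p e ≤ 1)
    {X Y : Set (Finset (Sym2 V))} (hX : IsUpperSet X) (hY : IsUpperSet Y) :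
    PrW D p X * PrW D p Y ≤
      ∑ K ∈ D.powerset, wtW D p K * condSumW D p (revealedAt D N) X K *
        condSumW D p (revealedAt D N) Y K := by
  have h := PrW_mul_PrW_le_Pr2W_hybrid D N hp0 hp1 hX hY
  rw [← sum_wtW_ind_mul_condSumW]
  refine h.trans (le_of_eq ?_)
  rw [Pr2W_eq_sum_ind, Finset.sum_product]
  refine Finset.sum_congr rfl fun K _ => ?_
  unfold condSumW
  rw [Finset.mul_sum]
  refine Finset.sum_congr rfl fun K₂ _ => ?_
  have : ind {c : Finset (Sym2 V) × Finset (Sym2 V) | c.1 ∈ X ∧ splice (revealedAt D N c.1) c.1 c.2 ∈ Y}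
      (K, K₂) = ind X K * ind Y (splice (revealedAt D N K) K K₂) := by
    by_cases h1 : K ∈ X
    · by_cases h2 : splice (revealedAt D N K) K K₂ ∈ Y
      · rw [ind_of_mem h1, ind_of_mem h2, ind_of_mem (show (K, K₂) ∈ {c : Finset (Sym2 V) × Finset (Sym2 V) |
          c.1 ∈ X ∧ splice (revealedAt D N c.1) c.1 c.2 ∈ Y} from ⟨h1, h2⟩)]
        ring
      · rw [ind_of_not_mem h2, ind_of_not_mem (show (K, K₂) ∉ {c : Finset (Sym2 V) × Finset (Sym2 V) |
          c.1 ∈ X ∧ splice (revealedAt D N c.1) c.1 c.2 ∈ Y} from fun h => h2 h.2)]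
        ring
    · rw [ind_of_not_mem h1, ind_of_not_mem (show (K, K₂) ∉ {c : Finset (Sym2 V) × Finset (Sym2 V) |
        c.1 ∈ X ∧ splice (revealedAt D N c.1) c.1 c.2 ∈ Y} from fun h => h1 h.1)]
      ring
  rw [this, wt2W]
  ring

end HK

end SetClusterExploration

end Literature.Probability.Percolation

end
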